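import Literature.Analysis.FluidPDE.Ferrari1993PressureEstimateProofs
import HarnessLib

/-!
# `Ferrari1993_periodicCylinderContinuation` on its two remaining leaves

Topic `Literature/Analysis/FluidPDE`. Assembly file recording the outcome of the split reviews
(D-0026) of the named fact `Literature.Analysis.FluidPDE.Ferrari1993_periodicCylinderContinuation`
(`ChenHouContinuationProofs.lean`): the contrapositive of A. B. Ferrari, *On the blow-up of
solutions of the 3-D Euler equations in a bounded domain*, Comm. Math. Phys. **155** (1993),
Thm 2 p. 279, in the smooth periodic class and in its weakest printed form (`sup |ω| < ∞` on a
bounded `[0, T)` ⟹ the solution is continued past `T`, the restart being Thm 1 p. 279 =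
Kato–Lai 1984 Thms I–II), the continuation half of the BKM dichotomy
`Ferrari1993_periodicCylinderEulerBKM` (`ChenHouContinuation.lean`).

**Review verdict.** The fact is well cut — it is one printed theorem, the parent is proved from
it and local existence (`Ferrari1993_periodicCylinderEulerBKM_of_localExistence_of_continuation`),
and its statement was checked against the held text (Thm 2 and the continuation argument
pp. 282–283: "Theorem 1 then guarantees the existence of an interval `[0, T₁]` … with `T₁`
depending only on `2K` … we may extend `u(t)` in `H^s(Ω)` to `t ∈ [T₁, T₂]` where `T₂ = 2T₁`").
Every step of Ferrari's proof of Thm 2 between the statement and the elliptic/existence theory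
is **proved** in the tree: the continuation argument (`Ferrari1993Continuation.lean`), uniqueness
(`KatoLaiPeriodicCylinderProofs.lean`), the Gronwall step (15)–(17) (`Ferrari1993H3Bound.lean`,
`Ferrari1993H3BoundRegularity.lean`), the `D^α`-energy method (8)–(14)
(`Ferrari1993EnergyIdentity.lean`, `Ferrari1993EnergyInequalityReduction.lean`), Lemma 1 ii)
(`Ferrari1993MoserInequality.lean`), Lemma 2 (`Ferrari1993PressureEstimateProofs.lean` with the
`PeriodicCylinderNeumann*` files), conservation of energy and the passage to `W^{1,∞}(cell)`
(`Ferrari1993LogEstimateReduction.lean`), and — inside the proof of the logarithmic estimate —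
the choice of the radius `δ` (72) p. 293, "(31) from (30)" p. 286 and the scaling equivalences
between the `δ`-families and the logarithmic forms (`PeriodicCylinderLogDivCurl.lean`,
`Ferrari1993Prop1DeltaFamily.lean`, `Ferrari1993Prop1LogEstimate.lean`). What remains are two
named facts which are distinct published results with their own locators, not slices of this
fact:

* `ShirotaYanagisawa1993_periodicCylinderLogDivCurlEstimate` — the stationary logarithmic
  div–curl estimate for one velocity field (Ferrari's Cor. 1 (31) p. 286 read for a single
  field, equivalently Shirota–Yanagisawa 1993 (15) p. 80 before the energy inequality (17) is
  invoked; `Ferrari1993LogEstimateReduction.lean`): the potential theory of the div–curl system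
  up to the curved wall (Ferrari's Prop. 1 with Thms 3–4 p. 285, Solonnikov's Green matrix and
  the Agmon–Douglis–Nirenberg estimate). Its former decomposition descendants — the `δ`-family
  `ShirotaYanagisawa1993_periodicCylinderDeltaLogDivCurlEstimate`, Ferrari's Prop. 1
  `Ferrari1993_periodicCylinderVorticityH2LogEstimate`, Ferrari's global `δ`-estimate (71)
  `Ferrari1993_periodicCylinderVorticityH2DeltaLogEstimate` and the Green-matrix fact
  `Ferrari1993_periodicCylinderGreenMatrix` — were all merged back by their split reviews (each
  is the estimate reworded or strengthened, equivalent to its parent by the choice of `δ` one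
  way and by the scaling `v ↦ c v` the other, and each carries the whole difficulty; review
  records in `PeriodicCylinderLogDivCurl.lean`, `Ferrari1993Prop1LogEstimate.lean`,
  `Ferrari1993Prop1DeltaFamily.lean`, `PeriodicCylinderGreenMatrix.lean`);
* `KatoLai1984_periodicCylinderUniformExistence` — Kato–Lai 1984 Thm I (existence time depending
  only on `Φ_{s₀} = ‖φ‖_{H³}`) with Thm II (regularity), p. 17 of the held text
  (`Ferrari1993Continuation.lean`; the abstract Thm A is proved, `KatoLaiAbstractEvolutionProofs.lean`).

This file composes the proved pieces into the end-to-end statements on exactly these two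
hypotheses, Lemma 2 being discharged (`Ferrari1993_periodicCylinderPressureEstimate_holds`; the
records `…_of_pressure_of_divCurl` of `Ferrari1993MoserInequality.lean` keep the pressure
estimate as a hypothesis because the pressure proofs import that file). The discharge
`Ferrari1993_periodicCylinderContinuation_holds` is therefore the term
`Ferrari1993_periodicCylinderContinuation_of_logDivCurl_of_uniformExistence B_holds E_holds`
as soon as the two leaves are discharged; it cannot live in `ChenHouContinuationProofs.lean` itself
(every proof file of the chain imports that file), but belongs in a downstream `…Holds.lean`.
Nothing here is a new definition or named fact. (The previous version of this file stated the
same assemblies on Ferrari's (71); with that fact merged back, its written-out form still yields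
`ShirotaYanagisawa1993_periodicCylinderLogDivCurlEstimate` by
`ShirotaYanagisawa1993_periodicCylinderLogDivCurlEstimate_of_deltaLogEstimate`,
`Ferrari1993Prop1DeltaFamily.lean`, and hence everything below.)
-/

noncomputable section

namespace Literature.Analysis.FluidPDE

/-- **The a-priori `H³` bound (7) = (17) from the stationary log div–curl estimate alone**:
Lemma 1 ii) (`Ferrari1993_periodicCylinderMoserInequality_holds`) and Lemma 2
(`Ferrari1993_periodicCylinderPressureEstimate_holds`) being proved, the bound
`Ferrari1993_periodicCylinderH3Bound` rests on the single stationary estimate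
`ShirotaYanagisawa1993_periodicCylinderLogDivCurlEstimate`. [cite: Ferrari1993, §1 proof of Thm 2, (4) ⇒ (7) = (17) (pp. 279–282)] -/
theorem Ferrari1993_periodicCylinderH3Bound_of_logDivCurl
    (hB : ShirotaYanagisawa1993_periodicCylinderLogDivCurlEstimate) :
    Ferrari1993_periodicCylinderH3Bound :=
  Ferrari1993_periodicCylinderH3Bound_of_pressure_of_divCurl
    Ferrari1993_periodicCylinderPressureEstimate_holds hB

/-- **Continuation past a time of bounded vorticity (`Ferrari1993_periodicCylinderContinuation`)
on its two remaining leaves**: the stationary log div–curl estimate and Kato–Lai's uniform-time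
existence. With both discharged this term is `Ferrari1993_periodicCylinderContinuation_holds`.
[cite: Ferrari1993, Thm 2 (p. 279) and its proof pp. 279–283] -/
theorem Ferrari1993_periodicCylinderContinuation_of_logDivCurl_of_uniformExistence
    (hB : ShirotaYanagisawa1993_periodicCylinderLogDivCurlEstimate)
    (hE : KatoLai1984_periodicCylinderUniformExistence) :
    Ferrari1993_periodicCylinderContinuation :=
  Ferrari1993_periodicCylinderContinuation_of_H3Bound_of_uniformExistence
    (Ferrari1993_periodicCylinderH3Bound_of_logDivCurl hB) hE

/-- **The BKM criterion in the periodic cylinder (`Ferrari1993_periodicCylinderEulerBKM`) on the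
same two leaves** (local existence from the uniform-time existence,
`Ferrari1993_periodicCylinderEulerBKM_of_H3Bound_of_uniformExistence`). [cite: Ferrari1993, Thms 1–2 (p. 279) and p. 277 (maximal interval of existence)] -/
theorem Ferrari1993_periodicCylinderEulerBKM_of_logDivCurl_of_uniformExistence
    (hB : ShirotaYanagisawa1993_periodicCylinderLogDivCurlEstimate)
    (hE : KatoLai1984_periodicCylinderUniformExistence) : Ferrari1993_periodicCylinderEulerBKM :=
  Ferrari1993_periodicCylinderEulerBKM_of_H3Bound_of_uniformExistence
    (Ferrari1993_periodicCylinderH3Bound_of_logDivCurl hB) hE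

/-- **The Chen–Hou blow-up (`chen_hou_blowup`) on the two leaves and Chen–Hou's a-priori
blow-up estimates** — the trust base of ns.S29 (ii) after the split reviews:
`ShirotaYanagisawa1993_periodicCylinderLogDivCurlEstimate`, `KatoLai1984_periodicCylinderUniformExistence`,
`ChenHou2022_aprioriBlowupEstimates`. [cite: arXiv221007191, §1 Theorem 2 (p. 3) and §6.1 Theorem 4 (p. 54)] -/
theorem chen_hou_blowup_of_logDivCurl_of_uniformExistence
    (hB : ShirotaYanagisawa1993_periodicCylinderLogDivCurlEstimate)
    (hE : KatoLai1984_periodicCylinderUniformExistence)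
    (hCH : ChenHou2022_aprioriBlowupEstimates) : chen_hou_blowup :=
  chen_hou_blowup_of_H3Bound_of_uniformExistence
    (Ferrari1993_periodicCylinderH3Bound_of_logDivCurl hB) hE hCH

end Literature.Analysis.FluidPDE
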